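/-
Copyright (c) 2026 the pub-hodgecm-mathlib formalisation cell (harness21).  Prover seat hodgecm-mathlib-K2E4-p11 (g5), Track B ∕ K2-LIT, h413 =
`stmt-HodgeConjecture-24833`, line `K2_E1_TraceFormulaBeta`, campaign «EIS-RANK-ONE» ∕ R8-LADDER-2, «MS-2» — THE OPERATOR ROAD, PART (O2b) (dealer K2E1-plan (g6) ruling (66)):
the Siegel section `σ : 𝔛_T → Z_T` and the transport operator `M : L²(Z_T, μZ) →L[ℂ] L²(𝔛, μ)`, RANK-GENERIC on ★ S-α's binder `hSieg` (letter-free at `N = 2, 3`).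
-/
import Summits.HodgeConjecture.HodgeConjecture.Theorems.K2E1BLSiegelTransportU                 -- ★ p859398 (K2E1-p12 g0) S-α: `supHeight_pZX_eq_of_one_lt`, UP∕DOWN, brings ★ unfolding `exists_forall_mul_lintegral_comp_pZX_eq`, `w₁` facts
import Literature.MeasureTheory.Group.InvariantQuotientUnfolding                                   -- ★ `measurable_quotient_iff`
import Literature.NumberTheory.Automorphic.UnitaryGroupKernelDictionary                            -- ★ `isClosed_quotientSubgroup_quasiSplit`, `quotientSubgroup_quasiSplit`
import HarnessLib

/-!
# h413 ∕ Track B «K2-LIT», «MS-2» — `K2E1BLSiegelSectionU` (RANK `N` on the Siegel binder `hSieg`; letter-free at `N = 2, 3`): THE MEASURABLE SIEGEL SECTION `σ : 𝔛 → Z`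
# (`σ[g⁻¹] = B(F)·g` for `H(g) > T ≥ 1`) AND THE TRANSPORT OPERATOR `M : 𝓗_0(Z_T) = L²(Z_T, μZ) →L[ℂ] L²(𝔛, μ)`, `M f = 𝟙_{T < w₁}·(f ∘ σ)`, `‖M f‖ = C^{1/2}‖f‖`

Cell `pub/hodgecm-mathlib`, crux H413 = `stmt-HodgeConjecture-24833`, route `HCCMUnconditional`; dealer K2E1-plan (g6) ruling (66) (operator road (O), part (O2)).  THEOREMS ONLY;
lane `--kind proof --supports stmt-HodgeConjecture-24833 --as helper` (count-neutral; closes no socket).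
THE MATHEMATICS [Garrett2018, §1.5, §2.3; BernsteinLapid2019, §4 Claim 4 p. 10; MoeglinWaldspurger1995, I.2.1].  Reduction theory in `F`-rank one (the binder `hSieg`: for `γ ∈ G(F) ∖ B(F)`
and `H(g) > 1`, `H(γ g) < 1` — ★ big cell at `N = 2, 3`) says that above the cut-off `T ≥ 1` a point `x = [x̃] ∈ 𝔛` has AT MOST ONE class `B(F)·δ` (`δ ∈ G(F)`) with `H(δ x̃⁻¹) > T` (§1),
and it has one iff `w₁(x) = sup_δ H(δ x̃⁻¹) > T`.  Hence the SIEGEL SECTION `σ : 𝔛 → Z = B(F)∖G(𝔸)`, `x ↦ B(F)·δ_x x̃⁻¹` on `𝔛_T = {T < w₁}` (anything on the rest), is well defined,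
inverse to `p : Z_T → 𝔛_T` (`σ[g⁻¹] = B(F)·g` for `H(g) > T`, `p ∘ σ = id` and `HZ ∘ σ = w₁` on `𝔛_T`), and MEASURABLE: its lift to `G(𝔸)` is locally the continuous map `y ↦ B(F)·δ y⁻¹`
on the open sets `{T < H(δ y⁻¹)}` and constant off their union (§2; descent by ★ `measurable_quotient_iff`).  The fibre count of `p` over `x` above the cut-off is then
`Σ'_q 𝟙_{T<H}(H⁻¹)^{2k}(q̃ x̃⁻¹) = 𝟙_{T<w₁(x)}·w₁(x)^{−2k}` (§3), so the unfolding ★ `exists_forall_mul_lintegral_comp_pZX_eq` at `k = 0` reads `C·∫_{Z_T} Φ∘p dμZ = ∫_{𝔛_T} Φ dμ`: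
the map `f ↦ 𝟙_{T<w₁}·(f∘σ)` is, up to the constant `C^{1/2}`, an ISOMETRY `M : L²(Z_T, μZ) →L[ℂ] L²(𝔛, μ)` (§4), with `(M f)∘p = f` a.e. on `Z_T`; and a.e.-statements on `Z_T`
pull back through `σ` to a.e.-statements on `𝔛_T` (§5, ★ S-α DOWN).  With ★ (O2a) `K_Z` this gives the high-cusp operator `K_T := M ∘L K_Z : 𝓗_k(𝔛) →L L²(𝔛, μ)` of ★ (O1)+(O3)
`exists_family_of_operator_letters` ((O2c)).
* §1 `arith_mul_inv_mem_arithmeticBorel_of_lt`, `toBorelQuotient_arith_mul_eq_of_lt` — uniqueness of the high translate.   §2 `toAutomorphicQuotient_inv_arithmetic_mul_out_inv`,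
  **`exists_siegelSection`**.   §3 `tsum_indicator_fibre_eq`.   §6 `N = 2, 3`: `exists_siegelSection_two∕three`.   (§4 `M` and §5 live in the companion ★ `K2E1BLSiegelTransportOperatorU`.)
HONEST LABEL.  Count-neutral helper; proves no printed statement; HC_CM is proved only modulo the 7 printed citations (2 remaining named inputs: hLiu418 = `stmt-HodgeConjecture-24832`,
h413 = `stmt-HodgeConjecture-24833`) until rung 0 closes.

## References
* [Garrett2018] P. Garrett, *Modern analysis of automorphic forms by example* (2018), §1.5, §2.3.
* [BernsteinLapid2019] J. Bernstein, E. Lapid, *On the meromorphic continuation of Eisenstein series*, J. AMS 37 (2024), §4 Claim 4 (p. 10).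
* [MoeglinWaldspurger1995] C. Mœglin, J.-L. Waldspurger, *Spectral decomposition and Eisenstein series* (1995), I.2.1.
-/

set_option autoImplicit false
set_option linter.dupNamespace false  -- the mandated namespace repeats the summit's segment (`HodgeConjecture.HodgeConjecture`)

noncomputable section

open MeasureTheory Measure NumberField IsDedekindDomain Set Filter Topology
open scoped ENNReal NNReal
open Literature.MeasureTheory.Group Literature.NumberTheory.Automorphic Literature.NumberTheory.Automorphic.UnitaryGroup AdelicGroupData
open Summit.HodgeConjecture.HodgeConjecture.Cruxes.H413.K2E1BLBorelSpacesU2Defs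
open Summit.HodgeConjecture.HodgeConjecture.Cruxes.H413.K2E1BLIotaUnfoldingU (measurable_pZX borelHeight_arithmeticBorel_mul' measurable_borelQuotHeight)
open Summit.HodgeConjecture.HodgeConjecture.Cruxes.H413.K2E1BLHeckeOperatorHXU2 (supHeight_toAutomorphicQuotient supHeight_pos measurable_supHeight measurable_weightX)
open Summit.HodgeConjecture.HodgeConjecture.Cruxes.H413.K2E1BLHeckeOperatorWeightedU2 (bddAbove_range_borelHeight_arith_mul)
open Summit.HodgeConjecture.HodgeConjecture.Cruxes.H413.K2E1BLSiegelTransportU (supHeight_pZX_eq_of_one_lt borelHeight_out_mk_mul')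

namespace Summit.HodgeConjecture.HodgeConjecture.Cruxes.H413.K2E1BLSiegelSectionU

variable {F E : Type} [Field F] [NumberField F] [Field E] [NumberField E] [Algebra F E] {c : E ≃ₐ[F] E} {N : ℕ} [NeZero N]

/-! ## §1 Above the cut-off the high translate is unique modulo `B(F)` -/

/-- **TWO HIGH TRANSLATES DIFFER BY `B(F)`**: on `hSieg`, if `T ≥ 1` and both `H(δ₁ y)`, `H(δ₂ y) > T` (`δᵢ ∈ G(F)`), then `δ₂ δ₁⁻¹ ∈ B(F)` — else `hSieg` at `g = δ₁ y` (`H(g) > 1`) gives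
`H(δ₂ y) < 1 ≤ T`. [cite: Garrett2018, §1.5 and §2.3] -/
theorem arith_mul_inv_mem_arithmeticBorel_of_lt
    (hSieg : ∀ γ : (quasiSplit F E c N).arithmeticSubgroup, γ ∉ arithmeticBorel F E c N → ∀ g : (quasiSplit F E c N).Adelic,
      1 < borelHeight g → borelHeight ((γ : (quasiSplit F E c N).Adelic) * g) < 1)
    {T : ℝ≥0} (hT : 1 ≤ T) {δ₁ δ₂ : (quasiSplit F E c N).arithmeticSubgroup} {y : (quasiSplit F E c N).Adelic}
    (h₁ : T < borelHeight ((δ₁ : (quasiSplit F E c N).Adelic) * y)) (h₂ : T < borelHeight ((δ₂ : (quasiSplit F E c N).Adelic) * y)) :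
    δ₂ * δ₁⁻¹ ∈ arithmeticBorel F E c N := by
  by_contra hγ
  have h := hSieg (δ₂ * δ₁⁻¹) hγ ((δ₁ : (quasiSplit F E c N).Adelic) * y) (hT.trans_lt h₁)
  rw [Subgroup.coe_mul, Subgroup.coe_inv, mul_assoc, inv_mul_cancel_left] at h
  exact absurd (hT.trans_lt h₂) (not_lt.2 h.le)

/-- **THE CLASS `B(F)·δ y` OF A HIGH TRANSLATE IS UNIQUE** (`T ≥ 1`, binder `hSieg`). [cite: Garrett2018, §1.5 and §2.3] [cite: BernsteinLapid2019, §4 Claim 4 (p. 10)] -/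
theorem toBorelQuotient_arith_mul_eq_of_lt
    (hSieg : ∀ γ : (quasiSplit F E c N).arithmeticSubgroup, γ ∉ arithmeticBorel F E c N → ∀ g : (quasiSplit F E c N).Adelic,
      1 < borelHeight g → borelHeight ((γ : (quasiSplit F E c N).Adelic) * g) < 1)
    {T : ℝ≥0} (hT : 1 ≤ T) {δ₁ δ₂ : (quasiSplit F E c N).arithmeticSubgroup} {y : (quasiSplit F E c N).Adelic}
    (h₁ : T < borelHeight ((δ₁ : (quasiSplit F E c N).Adelic) * y)) (h₂ : T < borelHeight ((δ₂ : (quasiSplit F E c N).Adelic) * y)) :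
    toBorelQuotient F E c N ((δ₁ : (quasiSplit F E c N).Adelic) * y) = toBorelQuotient F E c N ((δ₂ : (quasiSplit F E c N).Adelic) * y) := by
  have hmem := arith_mul_inv_mem_arithmeticBorel_of_lt hSieg hT h₁ h₂
  have hrat : ((δ₂ : (quasiSplit F E c N).Adelic) * ((δ₁ : (quasiSplit F E c N).Adelic))⁻¹) ∈ ratBorelSubgroup F E c N := by
    refine Subgroup.mem_inf.2 ⟨?_, ?_⟩
    · have h := (mem_arithmeticBorel_iff _).1 hmem
      rwa [Subgroup.coe_mul, Subgroup.coe_inv] at h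
    · exact Subgroup.mul_mem _ δ₂.2 (Subgroup.inv_mem _ δ₁.2)
  symm
  rw [toBorelQuotient_eq_iff]
  exact ⟨⟨_, hrat⟩, by simp only [mul_assoc, inv_mul_cancel_left]⟩

/-! ## §2 The measurable Siegel section `σ : 𝔛 → Z` -/

omit [NeZero N] in
/-- A point of `𝔛` is the class of the inverse of `δ·x̃⁻¹` for every `δ ∈ G(F)` (`x̃ = out x`): `[(δ·x̃⁻¹)⁻¹] = [x̃·δ⁻¹] = [x̃] = x` (rank `N`). [cite: BernsteinLapid2019, §4 p. 10] -/
theorem toAutomorphicQuotient_inv_arithmetic_mul_out_inv (x : (quasiSplit F E c N).automorphicQuotient) (δ : (quasiSplit F E c N).arithmeticSubgroup) :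
    (quasiSplit F E c N).toAutomorphicQuotient
        ((δ : (quasiSplit F E c N).Adelic) * (Quotient.out (x : (quasiSplit F E c N).Adelic ⧸ (quasiSplit F E c N).quotientSubgroup))⁻¹)⁻¹ = x := by
  have hx : (quasiSplit F E c N).toAutomorphicQuotient (Quotient.out (x : (quasiSplit F E c N).Adelic ⧸ (quasiSplit F E c N).quotientSubgroup)) = x :=
    QuotientGroup.out_eq' _
  conv_rhs => rw [← hx]
  rw [_root_.mul_inv_rev, inv_inv]
  change (QuotientGroup.mk _ : (quasiSplit F E c N).Adelic ⧸ (quasiSplit F E c N).quotientSubgroup) = QuotientGroup.mk _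
  rw [QuotientGroup.eq, _root_.mul_inv_rev, inv_inv, mul_assoc, inv_mul_cancel, mul_one, quotientSubgroup_quasiSplit]
  exact δ.2

variable [MeasurableSpace (quasiSplit F E c N).Adelic] [BorelSpace (quasiSplit F E c N).Adelic]

/-- **THE MEASURABLE SIEGEL SECTION.**  On `hSieg` and for `T ≥ 1` there is a measurable `σ : 𝔛 → Z` with `σ[g⁻¹] = B(F)·g` whenever `H(g) > T`; consequently on `𝔛_T = {T < w₁}`:
`p (σ x) = x` and `HZ (σ x) = w₁ x` (★ S-α `supHeight_pZX_eq_of_one_lt`).  Construction: lift `S(y) := B(F)·δ y⁻¹` if some `δ ∈ G(F)` has `H(δ y⁻¹) > T` (well defined by §1), else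
`B(F)·1`; `S` is right-`G(F)`-invariant, so descends to `𝔛 = G(𝔸)/G(F)`; it is continuous on the open set `⋃_δ {T < H(δ y⁻¹)}` (locally `y ↦ B(F)·δ y⁻¹`) and constant off it, hence Borel,
and the descent is Borel by ★ `measurable_quotient_iff`. [cite: Garrett2018, §2.3] [cite: BernsteinLapid2019, §4 Claim 4 (p. 10)] -/
theorem exists_siegelSection
    (hSieg : ∀ γ : (quasiSplit F E c N).arithmeticSubgroup, γ ∉ arithmeticBorel F E c N → ∀ g : (quasiSplit F E c N).Adelic,
      1 < borelHeight g → borelHeight ((γ : (quasiSplit F E c N).Adelic) * g) < 1)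
    {T : ℝ≥0} (hT : 1 ≤ T) :
    ∃ σ : (quasiSplit F E c N).automorphicQuotient → borelQuotient F E c N, Measurable σ ∧
      (∀ g : (quasiSplit F E c N).Adelic, T < borelHeight g → σ ((quasiSplit F E c N).toAutomorphicQuotient g⁻¹) = toBorelQuotient F E c N g) ∧
      ∀ x : (quasiSplit F E c N).automorphicQuotient, T < supHeight F E c N x →
        pZX F E c N (σ x) = x ∧ borelQuotHeight F E c N (σ x) = supHeight F E c N x := by
  classical
  -- the lift `S` on `G(𝔸)`
  set P : (quasiSplit F E c N).Adelic → Prop := fun y => ∃ δ : (quasiSplit F E c N).arithmeticSubgroup, T < borelHeight ((δ : (quasiSplit F E c N).Adelic) * y⁻¹) with hPdef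
  set S : (quasiSplit F E c N).Adelic → borelQuotient F E c N := fun y =>
    if h : P y then toBorelQuotient F E c N ((h.choose : (quasiSplit F E c N).Adelic) * y⁻¹) else toBorelQuotient F E c N 1 with hSdef
  have hSloc : ∀ (y : (quasiSplit F E c N).Adelic) (δ : (quasiSplit F E c N).arithmeticSubgroup), T < borelHeight ((δ : (quasiSplit F E c N).Adelic) * y⁻¹) →
      S y = toBorelQuotient F E c N ((δ : (quasiSplit F E c N).Adelic) * y⁻¹) := by
    intro y δ hδ
    have hP : P y := ⟨δ, hδ⟩
    simp only [hSdef, dif_pos hP]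
    exact toBorelQuotient_arith_mul_eq_of_lt hSieg hT hP.choose_spec hδ
  have hSout : ∀ y : (quasiSplit F E c N).Adelic, ¬ P y → S y = toBorelQuotient F E c N 1 := fun y hy => by simp only [hSdef, dif_neg hy]
  -- right `G(F)`-invariance of `S`
  have hSinv : ∀ (y : (quasiSplit F E c N).Adelic) (γ : (quasiSplit F E c N).Adelic), γ ∈ (quasiSplit F E c N).quotientSubgroup → S (y * γ) = S y := by
    intro y γ hγ
    rw [quotientSubgroup_quasiSplit] at hγ
    have hkey : ∀ δ : (quasiSplit F E c N).arithmeticSubgroup,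
        ((δ * ⟨γ, hγ⟩ : (quasiSplit F E c N).arithmeticSubgroup) : (quasiSplit F E c N).Adelic) * (y * γ)⁻¹ = (δ : (quasiSplit F E c N).Adelic) * y⁻¹ := by
      intro δ; rw [Subgroup.coe_mul, _root_.mul_inv_rev, mul_assoc, mul_inv_cancel_left]
    by_cases hy : P y
    · obtain ⟨δ, hδ⟩ := hy
      have hδ' : T < borelHeight (((δ * ⟨γ, hγ⟩ : (quasiSplit F E c N).arithmeticSubgroup) : (quasiSplit F E c N).Adelic) * (y * γ)⁻¹) := by rw [hkey]; exact hδ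
      rw [hSloc y δ hδ, hSloc (y * γ) _ hδ', hkey]
    · have hy' : ¬ P (y * γ) := by
        rintro ⟨δ, hδ⟩
        refine hy ⟨δ * ⟨γ, hγ⟩⁻¹, ?_⟩
        have h1 : ((δ * ⟨γ, hγ⟩⁻¹ : (quasiSplit F E c N).arithmeticSubgroup) : (quasiSplit F E c N).Adelic) * y⁻¹ = (δ : (quasiSplit F E c N).Adelic) * (y * γ)⁻¹ := by
          rw [Subgroup.coe_mul, Subgroup.coe_inv, _root_.mul_inv_rev, mul_assoc]
        rw [h1]; exact hδ
      rw [hSout y hy, hSout _ hy']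
  -- measurability of `S`: open preimages are (open) ∪ (measurable)
  have hO : IsOpen {y : (quasiSplit F E c N).Adelic | P y} := by
    have h1 : {y : (quasiSplit F E c N).Adelic | P y} = ⋃ δ : (quasiSplit F E c N).arithmeticSubgroup, {y | T < borelHeight ((δ : (quasiSplit F E c N).Adelic) * y⁻¹)} := by
      ext y; simp only [hPdef, Set.mem_setOf_eq, Set.mem_iUnion]
    rw [h1]
    exact isOpen_iUnion fun δ => isOpen_lt continuous_const (continuous_borelHeight.comp (continuous_const.mul continuous_inv))
  have hSm : Measurable S := by
    refine measurable_of_isOpen fun V hV => ?_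
    have hsplit : S ⁻¹' V = ({y | P y} ∩ S ⁻¹' V) ∪ ({y | P y}ᶜ ∩ S ⁻¹' V) := by rw [← Set.union_inter_distrib_right, Set.union_compl_self, Set.univ_inter]
    rw [hsplit]
    refine MeasurableSet.union (IsOpen.measurableSet ?_) ?_
    · rw [isOpen_iff_forall_mem_open]
      rintro y ⟨⟨δ, hδ⟩, hyV⟩
      refine ⟨{y' | T < borelHeight ((δ : (quasiSplit F E c N).Adelic) * y'⁻¹)} ∩ (fun y' => toBorelQuotient F E c N ((δ : (quasiSplit F E c N).Adelic) * y'⁻¹)) ⁻¹' V,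
        fun y' hy' => ⟨⟨δ, hy'.1⟩, ?_⟩, ?_, ⟨hδ, ?_⟩⟩
      · show S y' ∈ V
        rw [hSloc y' δ hy'.1]; exact hy'.2
      · exact (isOpen_lt continuous_const (continuous_borelHeight.comp (continuous_const.mul continuous_inv))).inter
          (hV.preimage ((continuous_toBorelQuotient (F := F) (E := E) (c := c) (N := N)).comp (continuous_const.mul continuous_inv)))
      · show toBorelQuotient F E c N ((δ : (quasiSplit F E c N).Adelic) * y⁻¹) ∈ V
        rw [← hSloc y δ hδ]; exact hyV
    · by_cases h1 : toBorelQuotient F E c N 1 ∈ V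
      · have h2 : {y : (quasiSplit F E c N).Adelic | P y}ᶜ ∩ S ⁻¹' V = {y | P y}ᶜ := by
          refine Set.inter_eq_left.2 fun y hy => ?_
          show S y ∈ V
          rw [hSout y hy]; exact h1
        rw [h2]; exact hO.isClosed_compl.measurableSet
      · have h2 : {y : (quasiSplit F E c N).Adelic | P y}ᶜ ∩ S ⁻¹' V = ∅ := by
          refine Set.eq_empty_iff_forall_notMem.2 fun y hy => h1 ?_
          rw [← hSout y hy.1]; exact hy.2
        rw [h2]; exact MeasurableSet.empty
  -- the descent `σ`
  set σ : (quasiSplit F E c N).automorphicQuotient → borelQuotient F E c N := fun x =>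
    S (Quotient.out (x : (quasiSplit F E c N).Adelic ⧸ (quasiSplit F E c N).quotientSubgroup)) with hσdef
  have hσmk : ∀ y : (quasiSplit F E c N).Adelic, σ ((quasiSplit F E c N).toAutomorphicQuotient y) = S y := by
    intro y
    obtain ⟨γ, hγ⟩ := QuotientGroup.mk_out_eq_mul (quasiSplit F E c N).quotientSubgroup y
    show S (Quotient.out ((QuotientGroup.mk y : (quasiSplit F E c N).Adelic ⧸ (quasiSplit F E c N).quotientSubgroup))) = S y
    rw [hγ]
    exact hSinv y γ γ.2
  refine ⟨σ, ?_, fun g hg => ?_, fun x hx => ?_⟩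
  · -- Borel descent (instance preamble as in ★ `K2E1TruncatedEisensteinL2.measurable_quotFun_…`)
    haveI := secondCountableTopology_adeleRing E
    haveI := locallyCompactSpace_adeleRing' E
    haveI : T2Space (quasiSplit F E c N).Adelic := inferInstanceAs (T2Space (adelic F E c N ((StdForm.antidiagonal N).over E)))
    haveI : LocallyCompactSpace (quasiSplit F E c N).Adelic := inferInstanceAs (LocallyCompactSpace (adelic F E c N ((StdForm.antidiagonal N).over E)))
    haveI : SecondCountableTopology (quasiSplit F E c N).Adelic :=
      inferInstanceAs (SecondCountableTopology (adelic F E c N ((StdForm.antidiagonal N).over E)))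
    letI : MeasurableSpace ((quasiSplit F E c N).Adelic ⧸ (quasiSplit F E c N).quotientSubgroup) := (quasiSplit F E c N).instMeasurableSpaceAutomorphicQuotient
    haveI : BorelSpace ((quasiSplit F E c N).Adelic ⧸ (quasiSplit F E c N).quotientSubgroup) := (quasiSplit F E c N).instBorelSpaceAutomorphicQuotient
    have h1 : σ ∘ (QuotientGroup.mk : (quasiSplit F E c N).Adelic → (quasiSplit F E c N).Adelic ⧸ (quasiSplit F E c N).quotientSubgroup) = S := funext fun y => hσmk y
    exact (Literature.MeasureTheory.Group.measurable_quotient_iff (G := (quasiSplit F E c N).Adelic) (H := (quasiSplit F E c N).quotientSubgroup)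
      isClosed_quotientSubgroup_quasiSplit (F := σ)).2 (h1 ▸ hSm)
  · rw [hσmk]
    have hg' : T < borelHeight (((1 : (quasiSplit F E c N).arithmeticSubgroup) : (quasiSplit F E c N).Adelic) * g⁻¹⁻¹) := by rwa [OneMemClass.coe_one, one_mul, inv_inv]
    rw [hSloc g⁻¹ 1 hg', OneMemClass.coe_one, one_mul, inv_inv]
  · -- a high translate `g = δ x̃⁻¹` exists; `x = [g⁻¹]`
    set xo : (quasiSplit F E c N).Adelic := Quotient.out (x : (quasiSplit F E c N).Adelic ⧸ (quasiSplit F E c N).quotientSubgroup) with hxodef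
    have hxmk : (quasiSplit F E c N).toAutomorphicQuotient xo = x := QuotientGroup.out_eq' _
    have hsup : supHeight F E c N x = ⨆ γ : (quasiSplit F E c N).arithmeticSubgroup, borelHeight ((γ : (quasiSplit F E c N).Adelic) * xo⁻¹) := by
      conv_lhs => rw [← hxmk]
      exact supHeight_toAutomorphicQuotient xo
    rw [hsup] at hx
    obtain ⟨δ, hδ⟩ := exists_lt_of_lt_ciSup hx
    have hxg : (quasiSplit F E c N).toAutomorphicQuotient ((δ : (quasiSplit F E c N).Adelic) * xo⁻¹)⁻¹ = x := toAutomorphicQuotient_inv_arithmetic_mul_out_inv x δ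
    have hσx : σ x = toBorelQuotient F E c N ((δ : (quasiSplit F E c N).Adelic) * xo⁻¹) := by
      conv_lhs => rw [← hxg]
      rw [hσmk]
      have hδ' : T < borelHeight (((1 : (quasiSplit F E c N).arithmeticSubgroup) : (quasiSplit F E c N).Adelic) * ((δ : (quasiSplit F E c N).Adelic) * xo⁻¹)⁻¹⁻¹) := by
        rwa [OneMemClass.coe_one, one_mul, inv_inv]
      rw [hSloc _ 1 hδ', OneMemClass.coe_one, one_mul, inv_inv]
    have h1 : 1 < borelQuotHeight F E c N (σ x) := by rw [hσx, borelQuotHeight_toBorelQuotient]; exact hT.trans_lt hδ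
    have hp : pZX F E c N (σ x) = x := by rw [hσx, pZX_toBorelQuotient, hxg]
    exact ⟨hp, by rw [← supHeight_pZX_eq_of_one_lt hSieg h1, hp]⟩

/-! ## §3 The fibre count of `p` above the cut-off -/

omit [MeasurableSpace (quasiSplit F E c N).Adelic] [BorelSpace (quasiSplit F E c N).Adelic] in
/-- **THE FIBRE COUNT**: on `hSieg`, for `T ≥ 1` and every `x = [x̃] ∈ 𝔛`, `Σ'_{q ∈ B(F)∖G(F)} 𝟙_{T < H(q̃ x̃⁻¹)}·H(q̃ x̃⁻¹)^{−2k} = 𝟙_{T < w₁(x)}·w₁(x)^{−2k}` — at most one class is high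
(§1), one is high iff `w₁(x) > T` (`w₁ = sup`), and its height is `w₁(x)` (★ S-α `supHeight_pZX_eq_of_one_lt`). [cite: Garrett2018, §2.3] [cite: MoeglinWaldspurger1995, I.2.1] -/
theorem tsum_indicator_fibre_eq
    (hSieg : ∀ γ : (quasiSplit F E c N).arithmeticSubgroup, γ ∉ arithmeticBorel F E c N → ∀ g : (quasiSplit F E c N).Adelic,
      1 < borelHeight g → borelHeight ((γ : (quasiSplit F E c N).Adelic) * g) < 1)
    {T : ℝ≥0} (hT : 1 ≤ T) (k : ℕ) (x : (quasiSplit F E c N).automorphicQuotient) :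
    (∑' q : Quotient (QuotientGroup.rightRel (arithmeticBorel F E c N)),
      {y : (quasiSplit F E c N).Adelic | T < borelHeight y}.indicator (fun y => (((borelHeight y)⁻¹ ^ (2 * k) : ℝ≥0) : ℝ≥0∞))
        (((q.out : (quasiSplit F E c N).arithmeticSubgroup) : (quasiSplit F E c N).Adelic) *
          (Quotient.out (x : (quasiSplit F E c N).Adelic ⧸ (quasiSplit F E c N).quotientSubgroup))⁻¹)) =
      {x : (quasiSplit F E c N).automorphicQuotient | T < supHeight F E c N x}.indicator (fun x => (((supHeight F E c N x)⁻¹ ^ (2 * k) : ℝ≥0) : ℝ≥0∞)) x := by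
  set xo : (quasiSplit F E c N).Adelic := Quotient.out (x : (quasiSplit F E c N).Adelic ⧸ (quasiSplit F E c N).quotientSubgroup) with hxodef
  have hxmk : (quasiSplit F E c N).toAutomorphicQuotient xo = x := QuotientGroup.out_eq' _
  have hsup : supHeight F E c N x = ⨆ γ : (quasiSplit F E c N).arithmeticSubgroup, borelHeight ((γ : (quasiSplit F E c N).Adelic) * xo⁻¹) := by
    conv_lhs => rw [← hxmk]
    exact supHeight_toAutomorphicQuotient xo
  by_cases hx : T < supHeight F E c N x
  · rw [Set.indicator_of_mem (show x ∈ {x | T < supHeight F E c N x} from hx)]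
    have hx' := hx
    rw [hsup] at hx'
    obtain ⟨δ, hδ⟩ := exists_lt_of_lt_ciSup hx'
    set q₀ : Quotient (QuotientGroup.rightRel (arithmeticBorel F E c N)) := Quotient.mk (QuotientGroup.rightRel (arithmeticBorel F E c N)) δ with hq₀
    have hH₀ : borelHeight (((q₀.out : (quasiSplit F E c N).arithmeticSubgroup) : (quasiSplit F E c N).Adelic) * xo⁻¹) = borelHeight ((δ : (quasiSplit F E c N).Adelic) * xo⁻¹) :=
      borelHeight_out_mk_mul' δ xo⁻¹
    -- the height of the high translate is `w₁ x`
    have hw : borelHeight ((δ : (quasiSplit F E c N).Adelic) * xo⁻¹) = supHeight F E c N x := by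
      have hxg : (quasiSplit F E c N).toAutomorphicQuotient ((δ : (quasiSplit F E c N).Adelic) * xo⁻¹)⁻¹ = x := toAutomorphicQuotient_inv_arithmetic_mul_out_inv x δ
      have h1 := supHeight_pZX_eq_of_one_lt hSieg (show 1 < borelQuotHeight F E c N (toBorelQuotient F E c N ((δ : (quasiSplit F E c N).Adelic) * xo⁻¹)) by
        rw [borelQuotHeight_toBorelQuotient]; exact hT.trans_lt hδ)
      rw [pZX_toBorelQuotient, hxg, borelQuotHeight_toBorelQuotient] at h1
      exact h1.symm
    rw [tsum_eq_single q₀]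
    · rw [Set.indicator_of_mem (show _ ∈ {y : (quasiSplit F E c N).Adelic | T < borelHeight y} by rw [Set.mem_setOf_eq, hH₀]; exact hδ), hH₀, hw]
    · intro q hq
      by_cases hq' : T < borelHeight (((q.out : (quasiSplit F E c N).arithmeticSubgroup) : (quasiSplit F E c N).Adelic) * xo⁻¹)
      · -- `q.out · δ⁻¹ ∈ B(F)`, so `q = q₀`
        refine absurd ?_ hq
        have hmem := arith_mul_inv_mem_arithmeticBorel_of_lt hSieg hT hδ hq'
        have hmem' : δ * (q.out : (quasiSplit F E c N).arithmeticSubgroup)⁻¹ ∈ arithmeticBorel F E c N := by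
          have h := Subgroup.inv_mem _ hmem
          rwa [_root_.mul_inv_rev, inv_inv] at h
        rw [hq₀, ← Quotient.out_eq q]
        exact Quotient.sound (QuotientGroup.rightRel_apply.2 hmem')
      · exact Set.indicator_of_notMem (show _ ∉ {y : (quasiSplit F E c N).Adelic | T < borelHeight y} from hq') _
  · rw [Set.indicator_of_notMem (show x ∉ {x | T < supHeight F E c N x} from hx)]
    refine ENNReal.tsum_eq_zero.2 fun q => Set.indicator_of_notMem (show _ ∉ {y : (quasiSplit F E c N).Adelic | T < borelHeight y} from fun hq => hx ?_) _
    rw [hsup]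
    exact lt_of_lt_of_le hq (le_ciSup (bddAbove_range_borelHeight_arith_mul xo⁻¹) _)

/-! ## §6 `N = 2` and `N = 3`: the Siegel binder discharged (★ big cell) -/

end Summit.HodgeConjecture.HodgeConjecture.Cruxes.H413.K2E1BLSiegelSectionU

namespace Summit.HodgeConjecture.HodgeConjecture.Cruxes.H413.K2E1BLSiegelSectionU

variable {F E : Type} [Field F] [NumberField F] [Field E] [NumberField E] [Algebra F E] {c : E ≃ₐ[F] E}

/-- `N = 2`: **the measurable Siegel section**, letter-free (★ `borelHeight_mul_lt_one_of_not_mem_arithmeticBorel_two`). [cite: Garrett2018, §1.5 and §2.3] -/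
theorem exists_siegelSection_two [MeasurableSpace (quasiSplit F E c 2).Adelic] [BorelSpace (quasiSplit F E c 2).Adelic] {T : ℝ≥0} (hT : 1 ≤ T) :
    ∃ σ : (quasiSplit F E c 2).automorphicQuotient → borelQuotient F E c 2, Measurable σ ∧
      (∀ g : (quasiSplit F E c 2).Adelic, T < borelHeight g → σ ((quasiSplit F E c 2).toAutomorphicQuotient g⁻¹) = toBorelQuotient F E c 2 g) ∧
      ∀ x : (quasiSplit F E c 2).automorphicQuotient, T < supHeight F E c 2 x →
        pZX F E c 2 (σ x) = x ∧ borelQuotHeight F E c 2 (σ x) = supHeight F E c 2 x :=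
  exists_siegelSection (fun _ hγ _ hg => borelHeight_mul_lt_one_of_not_mem_arithmeticBorel_two hγ hg) hT

/-- `N = 3`: **the measurable Siegel section**, letter-free (★ `borelHeight_mul_lt_one_of_not_mem_arithmeticBorel`). [cite: Garrett2018, §1.5 and §2.3] [cite: Rogawski1990, §2.2 p. 13] -/
theorem exists_siegelSection_three [MeasurableSpace (quasiSplit F E c 3).Adelic] [BorelSpace (quasiSplit F E c 3).Adelic] {T : ℝ≥0} (hT : 1 ≤ T) :
    ∃ σ : (quasiSplit F E c 3).automorphicQuotient → borelQuotient F E c 3, Measurable σ ∧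
      (∀ g : (quasiSplit F E c 3).Adelic, T < borelHeight g → σ ((quasiSplit F E c 3).toAutomorphicQuotient g⁻¹) = toBorelQuotient F E c 3 g) ∧
      ∀ x : (quasiSplit F E c 3).automorphicQuotient, T < supHeight F E c 3 x →
        pZX F E c 3 (σ x) = x ∧ borelQuotHeight F E c 3 (σ x) = supHeight F E c 3 x :=
  exists_siegelSection (fun _ hγ _ hg => borelHeight_mul_lt_one_of_not_mem_arithmeticBorel hγ hg) hT

end Summit.HodgeConjecture.HodgeConjecture.Cruxes.H413.K2E1BLSiegelSectionU

end
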